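import Mathlib.Algebra.Order.Field.Basic
import Mathlib.Algebra.Order.BigOperators.Group.Finset
import Mathlib.Algebra.BigOperators.Ring.Finset
import Mathlib.Data.Real.Basic
import Mathlib.Tactic.Linarith
import Mathlib.Tactic.FieldSimp
import Mathlib.Tactic.Ring
import Mathlib.Tactic.Positivity
import HarnessLib

/-!
# R-H D-0121 (1)(b) T-OPTIMALITY — the FRACTIONAL-KNAPSACK LP of an averaging scheme: weak duality, the dual
# `Σ_c max(t_c + y·ŝ_c, 0)`, complementary slackness, and the FORCED WEIGHT LAW «every optimal scheme is 1 on ratio > y,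
# 0 on ratio < y» (generic, exact ordered-field arithmetic; PROOF-ONLY, 0 definitions)

abc-iut cell, rung LADDER-ABC:A2.RESCUE.H; HUMAN D-0121 (21-frontier 2026-08-27T02:09:10Z) question (1) T-OPTIMALITY «is the ~j² per-cell
weighting FORCED for any derivation of a IV-1.10-type inequality through the Cor 3.12 shape, or does an on-average-over-labels derivation need
strictly less identification mass?»; seat abc-iut-topt-pv-2 (prover 2/3, «forced weight law by duality»), task text = rh-lead g3
`plan/rescue/R-H/ROUND3/D0121-SPEC.md` v0 §1.2 «PROOF-ONLY `…/RHToptKnapsackDual.lean`: the fractional-knapsack weak+strong duality over a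
finite cell family in exact ℚ/ℝ arithmetic — the standard LP dual of §1.1 LP-2 with box constraints — and the complementary-slackness
characterisation of every optimal ω (= 1 on ratio > λ, 0 on ratio < λ)».

THE LP (D0121-SPEC §1.1 LP-2, per datum; cells `c` of a finite family `s`, TRIVIAL MASS `t c` (= `cellTrivialCost`, `≥ 0`), MODEL SLACK
`ŝ c` (certified exact slack `≥ 0` on licensed cells, `−t c + κ c < 0` on unlicensed ones); an AVERAGING SCHEME is a weight `ω : cells → [0,1]`):
    (P)  maximise the KEPT MASS `Σ_{c ∈ s} ω c · t c`  subject to  `0 ≤ ω c ≤ 1` and the NETTING constraint `Σ_{c ∈ s} ω c · ŝ c ≥ 0`.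
Its LP dual (multiplier `y ≥ 0` on the netting row, `u_c ≥ 0` on the box rows `ω c ≤ 1`; `u_c ≥ t c + y·ŝ c`) has value
    (D)  `g(y) := Σ_{c ∈ s} max(t c + y·ŝ c, 0)`  («`Σ ω t ≤ λ·0 + Σ max(t − λ|ŝ|, 0)·1`» of the SPEC, surplus cells folded in).
WHAT IS PROVED (over ANY linearly ordered field `𝕜` — `ℚ` for `decide`/`norm_num` certificates, `ℝ` for the cell's currency; the multiplier is
called `y`, not `λ`, which is a Lean keyword):
* §1 WEAK DUALITY `kept_le_dual`: every feasible `ω` and every `y ≥ 0` satisfy `Σ ω t ≤ g(y)`; the SLACKNESS IDENTITY `dual_sub_kept_eq`: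
  `g(y) − Σ ω t = y·Σ ω ŝ + Σ_c [max(t c + y ŝ c, 0) − ω c·(t c + y ŝ c)]`, a sum of non-negative terms.
* §2 COMPLEMENTARY SLACKNESS `kept_eq_dual_iff`: for feasible `ω`, `y ≥ 0`: `Σ ω t = g(y)` iff `y·Σ ω ŝ = 0` and, cell by cell, `ω c = 1`
  where the REDUCED COST `t c + y·ŝ c > 0` and `ω c = 0` where it is `< 0` (free where it vanishes); STRONG DUALITY IN CERTIFICATE FORM
  `optimal_of_complementarySlackness`: a feasible `ω⋆` satisfying these conditions at some `y ≥ 0` is OPTIMAL (`Σ ω t ≤ Σ ω⋆ t` for every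
  feasible `ω`) and `y` is dual-optimal with the same value.
* §3 THE FORCED WEIGHT LAW `forcedLaw_of_optimal`: once ONE certificate `(ω⋆, y)` as in §2 exists, EVERY optimal scheme `ω` (feasible with
  `Σ ω t = Σ ω⋆ t`) obeys the same law at the same `y`: `ω = 1` on reduced cost `> 0`, `ω = 0` on reduced cost `< 0`, netting row tight if
  `y > 0`; in RATIO language for a deficit cell (`ŝ c < 0`, ratio `t c/(−ŝ c)`): `ω c = 1` if the ratio exceeds `y`, `ω c = 0` if it is below
  `y` (`forced_one_of_lt_ratio`, `forced_zero_of_ratio_lt`), and a surplus cell with `t c > 0` is always kept whole (`forced_one_of_surplus`).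
  So the only freedom of an optimal scheme is on the TIE cells `t c + y·ŝ c = 0` — «greedy by ratio with one fractional label».
The EXISTENCE of a certificate for every finite table (strong duality proper, by the greedy threshold) and the WORKED INSTANCE on lp-1/lp-2's
rational certificate (FREY `p = 7`, `l = 107`, `j₀ = 31`) are appended as §4/§5 when the certificate of record lands (A≡B).
HONEST FRAMING: elementary LP arithmetic about a finite table of numbers; nothing here asserts that abc is proved or refuted, or that
[IUTchIII] Cor. 3.12 / [IUTchIV] Thm. 1.10 holds or fails at any datum, or takes a side on any author; the link «table ↔ datum» is the kit
certificate (computed ≠ proved); typed ≠ proved. References to the cell's currency (`cellTrivialCost`, `weightedDeficit`, `weightedTrivialMass`,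
p480491's weighted door) are READING AIDS in docstrings — this file imports none of them. [folklore] throughout (LP duality, Dantzig 1951 /
Gale–Kuhn–Tucker 1951; fractional knapsack, Dantzig 1957).
-/

namespace Summit.ABC.IUTFork.Repair.RH.ToptKnapsack

open Finset

variable {ι 𝕜 : Type*} [Field 𝕜] [LinearOrder 𝕜] [IsStrictOrderedRing 𝕜]

/-! ## §0. One cell: a weight in `[0,1]` against its reduced cost -/

section OneCell

variable {a r : 𝕜}

/-- For a weight `0 ≤ a ≤ 1` and any reduced cost `r`: `a·r ≤ max(r, 0)` (the box-constraint dual bound, one cell). [folklore] -/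
theorem mul_le_max_of_unit (h0 : 0 ≤ a) (h1 : a ≤ 1) : a * r ≤ max r 0 := by
  rcases le_or_gt 0 r with hr | hr
  · calc a * r ≤ 1 * r := mul_le_mul_of_nonneg_right h1 hr
      _ = r := one_mul r
      _ ≤ max r 0 := le_max_left _ _
  · have : a * r ≤ 0 := mul_nonpos_iff.mpr (Or.inl ⟨h0, hr.le⟩)
    exact this.trans (le_max_right _ _)

/-- **One-cell complementary slackness.** `a·r = max(r,0)` iff (`r > 0 ⟹ a = 1`) and (`r < 0 ⟹ a = 0`); at `r = 0` the weight is free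
(no sign hypothesis on the weight `a` is needed for the equivalence itself). [folklore] -/
theorem mul_eq_max_iff : a * r = max r 0 ↔ (0 < r → a = 1) ∧ (r < 0 → a = 0) := by
  rcases lt_trichotomy r 0 with hr | hr | hr
  · rw [max_eq_right hr.le]
    constructor
    · intro h
      exact ⟨fun h' => absurd hr (not_lt.mpr h'.le), fun _ => (mul_eq_zero.mp h).resolve_right hr.ne⟩
    · rintro ⟨-, h⟩
      rw [h hr, zero_mul]
  · subst hr
    simp
  · rw [max_eq_left hr.le]
    constructor
    · intro h
      refine ⟨fun _ => ?_, fun h' => absurd hr (not_lt.mpr h'.le)⟩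
      have h2 : (a - 1) * r = 0 := by rw [sub_mul, one_mul, h, sub_self]
      have := (mul_eq_zero.mp h2).resolve_right hr.ne'
      linarith
    · rintro ⟨h, -⟩
      rw [h hr, one_mul]

/-- The one-cell slack `max(r,0) − a·r` is non-negative for `0 ≤ a ≤ 1`. [folklore] -/
theorem cellSlack_nonneg (h0 : 0 ≤ a) (h1 : a ≤ 1) : 0 ≤ max r 0 - a * r :=
  sub_nonneg.mpr (mul_le_max_of_unit h0 h1)

end OneCell

/-! ## §1. Weak duality and the slackness identity -/

section WeakDuality

variable (s : Finset ι) (t ŝ ω : ι → 𝕜) (y : 𝕜)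

omit [IsStrictOrderedRing 𝕜] in
/-- **THE SLACKNESS IDENTITY.** `g(y) − Σ ω t = y·(Σ ω ŝ) + Σ_c [max(t c + y·ŝ c, 0) − ω c·(t c + y·ŝ c)]` — dual value minus kept mass is the
multiplier times the netting surplus plus the cellwise box slacks (pure algebra, no sign hypotheses). [folklore] -/
theorem dual_sub_kept_eq :
    ∑ c ∈ s, max (t c + y * ŝ c) 0 - ∑ c ∈ s, ω c * t c =
      y * ∑ c ∈ s, ω c * ŝ c + ∑ c ∈ s, (max (t c + y * ŝ c) 0 - ω c * (t c + y * ŝ c)) := by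
  rw [Finset.sum_sub_distrib, Finset.mul_sum]
  have h : ∑ c ∈ s, ω c * (t c + y * ŝ c) = ∑ c ∈ s, ω c * t c + ∑ c ∈ s, y * (ω c * ŝ c) := by
    rw [← Finset.sum_add_distrib]
    exact Finset.sum_congr rfl fun c _ => by ring
  rw [h]
  ring

variable {s t ŝ ω y}

/-- **WEAK DUALITY for the fractional knapsack (P).** If `0 ≤ ω ≤ 1` on `s`, the netting constraint `Σ ω ŝ ≥ 0` holds and `y ≥ 0`, then the
kept mass is at most the dual value: `Σ_{c∈s} ω c·t c ≤ Σ_{c∈s} max(t c + y·ŝ c, 0)`. (Reading: for ANY averaging scheme admitted by the weighted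
door p480491 in the LP-2 model, the kept trivial mass is bounded by every dual certificate.) [folklore] -/
theorem kept_le_dual (h0 : ∀ c ∈ s, 0 ≤ ω c) (h1 : ∀ c ∈ s, ω c ≤ 1) (hnet : 0 ≤ ∑ c ∈ s, ω c * ŝ c) (hy : 0 ≤ y) :
    ∑ c ∈ s, ω c * t c ≤ ∑ c ∈ s, max (t c + y * ŝ c) 0 := by
  have hid := dual_sub_kept_eq s t ŝ ω y
  have hslack : 0 ≤ ∑ c ∈ s, (max (t c + y * ŝ c) 0 - ω c * (t c + y * ŝ c)) :=
    Finset.sum_nonneg fun c hc => cellSlack_nonneg (h0 c hc) (h1 c hc)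
  have hyn : 0 ≤ y * ∑ c ∈ s, ω c * ŝ c := mul_nonneg hy hnet
  linarith

/-- Weak duality, mass form: the IDENTIFICATION MASS LEFT UNKEPT `Σ t − Σ ω t` by any feasible scheme is at least `Σ t − g(y)` for every `y ≥ 0`
(the kernel side of «T′ ≥ M − g(y)»). [folklore] -/
theorem total_sub_dual_le_unkept (h0 : ∀ c ∈ s, 0 ≤ ω c) (h1 : ∀ c ∈ s, ω c ≤ 1) (hnet : 0 ≤ ∑ c ∈ s, ω c * ŝ c)
    (hy : 0 ≤ y) :
    ∑ c ∈ s, t c - ∑ c ∈ s, max (t c + y * ŝ c) 0 ≤ ∑ c ∈ s, t c - ∑ c ∈ s, ω c * t c := by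
  have := kept_le_dual (t := t) h0 h1 hnet hy
  linarith

end WeakDuality

/-! ## §2. Complementary slackness and strong duality in certificate form -/

section ComplementarySlackness

variable {s : Finset ι} {t ŝ ω : ι → 𝕜} {y : 𝕜}

/-- **COMPLEMENTARY SLACKNESS.** For a feasible scheme (`0 ≤ ω ≤ 1`, `Σ ω ŝ ≥ 0`) and `y ≥ 0`: the kept mass EQUALS the dual value `g(y)` iff
(i) `y·Σ ω ŝ = 0` (the netting row is tight unless `y = 0`) and (ii) for every cell, `ω c = 1` where the reduced cost `t c + y·ŝ c` is `> 0` and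
`ω c = 0` where it is `< 0`. [folklore] -/
theorem kept_eq_dual_iff (h0 : ∀ c ∈ s, 0 ≤ ω c) (h1 : ∀ c ∈ s, ω c ≤ 1) (hnet : 0 ≤ ∑ c ∈ s, ω c * ŝ c) (hy : 0 ≤ y) :
    ∑ c ∈ s, ω c * t c = ∑ c ∈ s, max (t c + y * ŝ c) 0 ↔
      y * ∑ c ∈ s, ω c * ŝ c = 0 ∧
        ∀ c ∈ s, (0 < t c + y * ŝ c → ω c = 1) ∧ (t c + y * ŝ c < 0 → ω c = 0) := by
  have hid := dual_sub_kept_eq s t ŝ ω y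
  have hsl : ∀ c ∈ s, 0 ≤ max (t c + y * ŝ c) 0 - ω c * (t c + y * ŝ c) := fun c hc => cellSlack_nonneg (h0 c hc) (h1 c hc)
  have hslack : 0 ≤ ∑ c ∈ s, (max (t c + y * ŝ c) 0 - ω c * (t c + y * ŝ c)) := Finset.sum_nonneg hsl
  have hyn : 0 ≤ y * ∑ c ∈ s, ω c * ŝ c := mul_nonneg hy hnet
  constructor
  · intro heq
    have hgap : y * ∑ c ∈ s, ω c * ŝ c + ∑ c ∈ s, (max (t c + y * ŝ c) 0 - ω c * (t c + y * ŝ c)) = 0 := by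
      rw [← hid, heq, sub_self]
    have hy0 : y * ∑ c ∈ s, ω c * ŝ c = 0 := by linarith
    have hs0 : ∑ c ∈ s, (max (t c + y * ŝ c) 0 - ω c * (t c + y * ŝ c)) = 0 := by linarith
    rw [Finset.sum_eq_zero_iff_of_nonneg hsl] at hs0
    refine ⟨hy0, fun c hc => ?_⟩
    have hc0 : ω c * (t c + y * ŝ c) = max (t c + y * ŝ c) 0 := by linarith [hs0 c hc]
    exact mul_eq_max_iff.mp hc0
  · rintro ⟨hy0, hcs⟩
    have hs0 : ∑ c ∈ s, (max (t c + y * ŝ c) 0 - ω c * (t c + y * ŝ c)) = 0 :=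
      Finset.sum_eq_zero fun c hc => by
        rw [sub_eq_zero]
        exact (mul_eq_max_iff.mpr (hcs c hc)).symm
    linarith

/-- **STRONG DUALITY, CERTIFICATE FORM (optimality of the greedy scheme).** If a feasible scheme `ω⋆` and a multiplier `y ≥ 0` satisfy
complementary slackness — `y·Σ ω⋆ ŝ = 0`, `ω⋆ = 1` on positive reduced cost, `ω⋆ = 0` on negative reduced cost — then `ω⋆` attains the
dual value `g(y)`, hence is OPTIMAL for (P): every feasible `ω` keeps at most `Σ ω⋆ t`; and `y` minimises `g` over `y ≥ 0`. This is the shape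
in which lp-1/lp-2's rational certificates (optimal `ω`, multiplier, reduced costs) are consumed. [folklore] -/
theorem optimal_of_complementarySlackness {ω' : ι → 𝕜} (h0' : ∀ c ∈ s, 0 ≤ ω' c) (h1' : ∀ c ∈ s, ω' c ≤ 1)
    (hnet' : 0 ≤ ∑ c ∈ s, ω' c * ŝ c) (hy : 0 ≤ y) (htight : y * ∑ c ∈ s, ω' c * ŝ c = 0)
    (hcs : ∀ c ∈ s, (0 < t c + y * ŝ c → ω' c = 1) ∧ (t c + y * ŝ c < 0 → ω' c = 0))
    (h0 : ∀ c ∈ s, 0 ≤ ω c) (h1 : ∀ c ∈ s, ω c ≤ 1) (hnet : 0 ≤ ∑ c ∈ s, ω c * ŝ c) :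
    ∑ c ∈ s, ω c * t c ≤ ∑ c ∈ s, ω' c * t c := by
  rw [(kept_eq_dual_iff h0' h1' hnet' hy).mpr ⟨htight, hcs⟩]
  exact kept_le_dual h0 h1 hnet hy

/-- … and the certified scheme's kept mass IS the dual value: `Σ ω⋆ t = g(y)` (so `max (P) = g(y) = min_{y' ≥ 0} g(y')`, the second equality by
`kept_le_dual`). [folklore] -/
theorem kept_eq_dual_of_complementarySlackness {ω' : ι → 𝕜} (h0' : ∀ c ∈ s, 0 ≤ ω' c) (h1' : ∀ c ∈ s, ω' c ≤ 1)
    (hnet' : 0 ≤ ∑ c ∈ s, ω' c * ŝ c) (hy : 0 ≤ y) (htight : y * ∑ c ∈ s, ω' c * ŝ c = 0)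
    (hcs : ∀ c ∈ s, (0 < t c + y * ŝ c → ω' c = 1) ∧ (t c + y * ŝ c < 0 → ω' c = 0)) :
    ∑ c ∈ s, ω' c * t c = ∑ c ∈ s, max (t c + y * ŝ c) 0 :=
  (kept_eq_dual_iff h0' h1' hnet' hy).mpr ⟨htight, hcs⟩

/-- Dual optimality of the certificate's multiplier: `g(y) ≤ g(y')` for every `y' ≥ 0`. [folklore] -/
theorem dual_le_dual_of_complementarySlackness {ω' : ι → 𝕜} (h0' : ∀ c ∈ s, 0 ≤ ω' c) (h1' : ∀ c ∈ s, ω' c ≤ 1)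
    (hnet' : 0 ≤ ∑ c ∈ s, ω' c * ŝ c) (hy : 0 ≤ y) (htight : y * ∑ c ∈ s, ω' c * ŝ c = 0)
    (hcs : ∀ c ∈ s, (0 < t c + y * ŝ c → ω' c = 1) ∧ (t c + y * ŝ c < 0 → ω' c = 0)) {y' : 𝕜} (hy' : 0 ≤ y') :
    ∑ c ∈ s, max (t c + y * ŝ c) 0 ≤ ∑ c ∈ s, max (t c + y' * ŝ c) 0 := by
  rw [← kept_eq_dual_of_complementarySlackness h0' h1' hnet' hy htight hcs]
  exact kept_le_dual h0' h1' hnet' hy'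

end ComplementarySlackness

/-! ## §3. THE FORCED WEIGHT LAW: every optimal scheme is greedy-by-ratio at the certificate's threshold -/

section ForcedLaw

variable {s : Finset ι} {t ŝ ω ω' : ι → 𝕜} {y : 𝕜}

/-- **THE FORCED WEIGHT LAW.** Let `(ω⋆, y)` be a certificate as in §2 (feasible, `y ≥ 0`, complementary slackness). Then EVERY feasible scheme
`ω` with the optimal kept mass `Σ ω t = Σ ω⋆ t` (equivalently `≥`, by optimality) satisfies complementary slackness AT THE SAME `y`: the netting
row is tight (`y·Σ ω ŝ = 0`), `ω c = 1` wherever `t c + y·ŝ c > 0`, `ω c = 0` wherever `t c + y·ŝ c < 0`. The optimal weights are thus FORCED off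
the tie set `{c : t c + y·ŝ c = 0}`. [folklore] -/
theorem forcedLaw_of_optimal (h0' : ∀ c ∈ s, 0 ≤ ω' c) (h1' : ∀ c ∈ s, ω' c ≤ 1) (hnet' : 0 ≤ ∑ c ∈ s, ω' c * ŝ c)
    (hy : 0 ≤ y) (htight : y * ∑ c ∈ s, ω' c * ŝ c = 0)
    (hcs : ∀ c ∈ s, (0 < t c + y * ŝ c → ω' c = 1) ∧ (t c + y * ŝ c < 0 → ω' c = 0))
    (h0 : ∀ c ∈ s, 0 ≤ ω c) (h1 : ∀ c ∈ s, ω c ≤ 1) (hnet : 0 ≤ ∑ c ∈ s, ω c * ŝ c)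
    (hopt : ∑ c ∈ s, ω' c * t c ≤ ∑ c ∈ s, ω c * t c) :
    y * ∑ c ∈ s, ω c * ŝ c = 0 ∧
      ∀ c ∈ s, (0 < t c + y * ŝ c → ω c = 1) ∧ (t c + y * ŝ c < 0 → ω c = 0) := by
  have hval := kept_eq_dual_of_complementarySlackness h0' h1' hnet' hy htight hcs
  have hle := kept_le_dual (t := t) h0 h1 hnet hy
  have heq : ∑ c ∈ s, ω c * t c = ∑ c ∈ s, max (t c + y * ŝ c) 0 := le_antisymm hle (by rw [← hval]; exact hopt)
  exact (kept_eq_dual_iff h0 h1 hnet hy).mp heq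

/-- Forced law, netting row: if the certificate's multiplier is POSITIVE, every optimal scheme spends the whole surplus: `Σ ω ŝ = 0`. [folklore] -/
theorem net_eq_zero_of_optimal (h0' : ∀ c ∈ s, 0 ≤ ω' c) (h1' : ∀ c ∈ s, ω' c ≤ 1) (hnet' : 0 ≤ ∑ c ∈ s, ω' c * ŝ c)
    (hy : 0 < y) (htight : y * ∑ c ∈ s, ω' c * ŝ c = 0)
    (hcs : ∀ c ∈ s, (0 < t c + y * ŝ c → ω' c = 1) ∧ (t c + y * ŝ c < 0 → ω' c = 0))
    (h0 : ∀ c ∈ s, 0 ≤ ω c) (h1 : ∀ c ∈ s, ω c ≤ 1) (hnet : 0 ≤ ∑ c ∈ s, ω c * ŝ c)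
    (hopt : ∑ c ∈ s, ω' c * t c ≤ ∑ c ∈ s, ω c * t c) :
    ∑ c ∈ s, ω c * ŝ c = 0 := by
  have h := (forcedLaw_of_optimal h0' h1' hnet' hy.le htight hcs h0 h1 hnet hopt).1
  rcases mul_eq_zero.mp h with h | h
  · exact absurd h hy.ne'
  · exact h

/-- RATIO LANGUAGE, deficit cell. For `ŝ c < 0` the reduced cost `t c + y·ŝ c` is positive iff the cell's RATIO `t c/(−ŝ c)` exceeds `y`.
[folklore] -/
theorem reducedCost_pos_iff_lt_ratio {c : ι} (hs : ŝ c < 0) : 0 < t c + y * ŝ c ↔ y < t c / (-ŝ c) := by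
  have hpos : 0 < -ŝ c := neg_pos.mpr hs
  rw [lt_div_iff₀ hpos]
  constructor <;> intro h <;> linarith

/-- … and negative iff the ratio is below `y`. [folklore] -/
theorem reducedCost_neg_iff_ratio_lt {c : ι} (hs : ŝ c < 0) : t c + y * ŝ c < 0 ↔ t c / (-ŝ c) < y := by
  have hpos : 0 < -ŝ c := neg_pos.mpr hs
  rw [div_lt_iff₀ hpos]
  constructor <;> intro h <;> linarith

/-- **Forced law, deficit cells above the threshold are kept WHOLE**: in every optimal scheme, a cell with `ŝ c < 0` and ratio
`t c/(−ŝ c) > y` has `ω c = 1`. [folklore] -/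
theorem forced_one_of_lt_ratio (h0' : ∀ c ∈ s, 0 ≤ ω' c) (h1' : ∀ c ∈ s, ω' c ≤ 1) (hnet' : 0 ≤ ∑ c ∈ s, ω' c * ŝ c)
    (hy : 0 ≤ y) (htight : y * ∑ c ∈ s, ω' c * ŝ c = 0)
    (hcs : ∀ c ∈ s, (0 < t c + y * ŝ c → ω' c = 1) ∧ (t c + y * ŝ c < 0 → ω' c = 0))
    (h0 : ∀ c ∈ s, 0 ≤ ω c) (h1 : ∀ c ∈ s, ω c ≤ 1) (hnet : 0 ≤ ∑ c ∈ s, ω c * ŝ c)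
    (hopt : ∑ c ∈ s, ω' c * t c ≤ ∑ c ∈ s, ω c * t c) {c : ι} (hc : c ∈ s) (hs : ŝ c < 0) (hr : y < t c / (-ŝ c)) :
    ω c = 1 :=
  ((forcedLaw_of_optimal h0' h1' hnet' hy htight hcs h0 h1 hnet hopt).2 c hc).1 ((reducedCost_pos_iff_lt_ratio hs).mpr hr)

/-- **Forced law, deficit cells below the threshold are DROPPED**: in every optimal scheme, a cell with `ŝ c < 0` and ratio `t c/(−ŝ c) < y`
has `ω c = 0`. [folklore] -/
theorem forced_zero_of_ratio_lt (h0' : ∀ c ∈ s, 0 ≤ ω' c) (h1' : ∀ c ∈ s, ω' c ≤ 1) (hnet' : 0 ≤ ∑ c ∈ s, ω' c * ŝ c)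
    (hy : 0 ≤ y) (htight : y * ∑ c ∈ s, ω' c * ŝ c = 0)
    (hcs : ∀ c ∈ s, (0 < t c + y * ŝ c → ω' c = 1) ∧ (t c + y * ŝ c < 0 → ω' c = 0))
    (h0 : ∀ c ∈ s, 0 ≤ ω c) (h1 : ∀ c ∈ s, ω c ≤ 1) (hnet : 0 ≤ ∑ c ∈ s, ω c * ŝ c)
    (hopt : ∑ c ∈ s, ω' c * t c ≤ ∑ c ∈ s, ω c * t c) {c : ι} (hc : c ∈ s) (hs : ŝ c < 0) (hr : t c / (-ŝ c) < y) :
    ω c = 0 :=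
  ((forcedLaw_of_optimal h0' h1' hnet' hy htight hcs h0 h1 hnet hopt).2 c hc).2 ((reducedCost_neg_iff_ratio_lt hs).mpr hr)

/-- **Forced law, surplus cells with mass are kept WHOLE**: in every optimal scheme, a cell with `ŝ c ≥ 0` (licensed) and `t c > 0` has `ω c = 1`
(its reduced cost `t c + y·ŝ c` is positive for every `y ≥ 0`). [folklore] -/
theorem forced_one_of_surplus (h0' : ∀ c ∈ s, 0 ≤ ω' c) (h1' : ∀ c ∈ s, ω' c ≤ 1) (hnet' : 0 ≤ ∑ c ∈ s, ω' c * ŝ c)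
    (hy : 0 ≤ y) (htight : y * ∑ c ∈ s, ω' c * ŝ c = 0)
    (hcs : ∀ c ∈ s, (0 < t c + y * ŝ c → ω' c = 1) ∧ (t c + y * ŝ c < 0 → ω' c = 0))
    (h0 : ∀ c ∈ s, 0 ≤ ω c) (h1 : ∀ c ∈ s, ω c ≤ 1) (hnet : 0 ≤ ∑ c ∈ s, ω c * ŝ c)
    (hopt : ∑ c ∈ s, ω' c * t c ≤ ∑ c ∈ s, ω c * t c) {c : ι} (hc : c ∈ s) (hs : 0 ≤ ŝ c) (ht : 0 < t c) :
    ω c = 1 :=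
  ((forcedLaw_of_optimal h0' h1' hnet' hy htight hcs h0 h1 hnet hopt).2 c hc).1 (by nlinarith [mul_nonneg hy hs])

/-- **UNIQUENESS OFF THE TIE SET.** Two optimal schemes agree on every cell whose reduced cost at the certificate's `y` is non-zero: the optimal
weight vector is unique up to the tie cells `t c + y·ŝ c = 0` (on a generic table: unique up to the ONE fractional cell). [folklore] -/
theorem eq_on_nonTie_of_optimal (h0' : ∀ c ∈ s, 0 ≤ ω' c) (h1' : ∀ c ∈ s, ω' c ≤ 1) (hnet' : 0 ≤ ∑ c ∈ s, ω' c * ŝ c)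
    (hy : 0 ≤ y) (htight : y * ∑ c ∈ s, ω' c * ŝ c = 0)
    (hcs : ∀ c ∈ s, (0 < t c + y * ŝ c → ω' c = 1) ∧ (t c + y * ŝ c < 0 → ω' c = 0))
    (h0 : ∀ c ∈ s, 0 ≤ ω c) (h1 : ∀ c ∈ s, ω c ≤ 1) (hnet : 0 ≤ ∑ c ∈ s, ω c * ŝ c)
    (hopt : ∑ c ∈ s, ω' c * t c ≤ ∑ c ∈ s, ω c * t c) {c : ι} (hc : c ∈ s) (hne : t c + y * ŝ c ≠ 0) :
    ω c = ω' c := by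
  have hω := (forcedLaw_of_optimal h0' h1' hnet' hy htight hcs h0 h1 hnet hopt).2 c hc
  rcases lt_or_gt_of_ne hne with h | h
  · rw [hω.2 h, (hcs c hc).2 h]
  · rw [hω.1 h, (hcs c hc).1 h]

end ForcedLaw

end Summit.ABC.IUTFork.Repair.RH.ToptKnapsack
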